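/-
Copyright (c) 2026 the pub-hodgecm-mathlib formalisation cell (harness21).  Prover seat hodgecm-mathlib-LH1-p01 (g11): LH4 price-list item (P2g) «DEEP LEVEL SHIFT» (dealer
LH4-plan (g6) WORD #73), 2026-09-02.  Over ★ N3 `LevelTwoInteriorOrbitalTransport` (F0P2-p01 (g14)), ★ `LevelTwoLiftInteriorAdapters` (F0P2-p02 (g12)), ★ p851752, ★ p851712.
-/
import Literature.NumberTheory.Rogawski1990.LevelTwoLiftInteriorAdapters            -- ★ the `h2` adapter `exists_nhds_one_forall_shift_mem` (`stub_N5b` shape) this file de-`h2`'s; brings ★ N3 `isUnit_det_shift_denominators_of_deep`, `setOf_entrywise_deep_mem_nhds_one`, `forall_valued_endoEmbLocal_sub_one_le_of_blocks`, `finGammaTwo_of_coe_eq_moebius`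
import Literature.NumberTheory.Automorphic.UnitaryCarrierCongruenceNhdsBasisDyadic  -- ★ p851752: N5b WITHOUT `|2|_w = 1` (`exists_level_forall_shift_mem_of_mem_nhds_one_dyadic`), `exists_valued_two_eq_exp_neg`
import HarnessLib

/-!
# The deep Cayley shift at ANY residue characteristic: the `3 × 3` Möbius denominators of a `(j+1)`-deep `γ_H` are units once `|c|^j < |2|`, and
# `stub_N5b` («`u_H → 1` as `γ_H → 1`») with its `|2|_w = 1` binder deleted

Topic `NumberTheory/Rogawski1990`; namespace `Literature.NumberTheory.Rogawski1990` (= ★ `LevelTwoLiftInteriorAdapters`').  THEOREMS ONLY (no definition, no instance, no notation,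
no named fact, no `sorry`); kernel lane `--supports stmt-HodgeConjecture-24833`, count-neutral.  Cell `pub/hodgecm-mathlib` (D-0151), crux H413 = `stmt-HodgeConjecture-24833`, half A
line LH4, price-list item (P2g) of LH4-plan (g6) WORD #73 — the DYADIC INPUTS of the «deep-pair» candidate of the Q-D1 design memo (LH4-p02 (g8) (P2f) (ii)):
* (G1) `isUnit_det_shift_denominators_of_level` — ★ N3 `isUnit_det_shift_denominators_of_deep` («the two `3 × 3` denominators `det((c∓1)·ι_v(γ_H) + (c±1)·1)` of a 2-deep
  `γ_H` are units of `E_v`», `|c_w| = exp(−1)`, `|2|_w = 1`) with `(h2, 2-deep)` replaced by `((j+1)-deep, |c_w|^j < |2|_w)`: at `w` the denominators read `c_w³·det(2·1 + (c_w∓1)W)`,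
  `W = c_w⁻¹(ι_w − 1)`, `|W| ≤ |c_w|^j`, and `2·1 + tW = 2·(1 + 2⁻¹tW)` with `|2⁻¹ t W| ≤ |c_w|^j∕|2|_w < 1` — so `|det| = |c_w|³|2|³ ≠ 0` (★ `v_det_eq_one_of_forall_v_sub_one_lt_one`).
  ★'s head is the case `j = 1`, where the dominance `|c_w| < |2|_w` holds iff `v ∤ 2`; LH4-p02 (g8)'s (P2e) census rows «MÖB-deep» A:123∕A:170 made honest.
* (G2) `exists_nhds_one_forall_shift_mem_dyadic` — ★ `exists_nhds_one_forall_shift_mem` (`stub_N5b` in the END's socket shape) with the binder `(h2 : |2|_w = 1)` DELETED,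
  statement otherwise byte-identical (so it SUPERSEDES ★'s; ★'s file untouched): `|2|_w = exp(−e)` (★ `exists_valued_two_eq_exp_neg`), the level of ★ p851752's box is raised
  to `j := max j₀ (e+1)`, `V :=` the level-`(j+1)` box, and the denominators come from (G1) (`|c_w|^j < |2|_w` since `j ≥ e+1`).
NOT TYPED (census (P2g), LH4 bus 2026-09-02; FINDING #7 = Q-D1 input): the deep twins of N3 `classOrbitalIntegral_levelOneIndicator_eq_shift` and N4 `shifted_binders_of_typeOne`
— L-sized (four resp. six `|2| = 1` suppliers each) and consumer-less today (the END fold's scope is `v ∤ 2`; level-`(e+1)` pieces have no T3′ head).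
HONEST LABEL: HC_CM is proved only modulo the 7 printed citations (2 remaining named inputs: hLiu418 = stmt-HodgeConjecture-24832, h413 = stmt-HodgeConjecture-24833) until rung 0
closes; count-neutral (pays no organ, opens no road).

## References
* [Rogawski1990] J. D. Rogawski, *Automorphic Representations of Unitary Groups in Three Variables*, Ann. of Math. Stud. 123 (1990), §4.9 p. 54, Prop. 4.9.1 (a)(b) p. 55.
* [Kottwitz1986] R. E. Kottwitz, *Base change for unit elements of Hecke algebras*, Compositio Math. 60 (1986), §3.
* [BernsteinZelevinsky1976] I. N. Bernstein, A. V. Zelevinsky, *Representations of the group GL(n, F) where F is a non-archimedean local field*, Russian Math. Surveys 31 (1976), §1.1.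
* [Omeara1963] O. T. O'Meara, *Introduction to Quadratic Forms* (1963), §63 (levels relative to `ord 2`).
-/

set_option autoImplicit false

noncomputable section

open NumberField IsDedekindDomain MeasureTheory Measure Topology Filter Matrix Polynomial
open scoped MatrixGroups WithZero

namespace Literature.NumberTheory.Rogawski1990

open Literature.NumberTheory.Automorphic Literature.NumberTheory.Automorphic.UnitaryGroup Literature.NumberTheory.Automorphic.MoebiusShift
open Literature.NumberTheory.Automorphic.IntegralReduction Literature.NumberTheory.Automorphic.UnitaryLatticeTree
open Literature.NumberTheory.GaloisRepresentations Literature.NumberTheory.NumberFields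

/-! ## §1 (G1) The `E_v`-level Möbius denominators of a `(j+1)`-deep `γ_H` are units once `|c_w|^j < |2|_w` -/

/-- **(G1) The denominators `det((c∓1)ι_v(γ_H) + (c±1))` are units of `E_v`** for a `(j+1)`-deep `γ_H` at a non-split place under the dominance `|c_w|^j < |2|_w` (at
`|2|_w = exp(−e)`: `j ≥ e + 1`; ANY residue characteristic): at `w` they read `c_w³·det(2·1 + (c_w∓1)W)` with `W = c_w⁻¹(ι_w − 1)`, `|W| ≤ |c_w|^j`, and
`|det(2·1 + tW)| = |2|_w³` since `|2⁻¹ t W| < 1`; `E_v = L_w` has one factor.  ★ `isUnit_det_shift_denominators_of_deep` is the case `j = 1`, `|2|_w = 1`.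
[cite: Kottwitz1986, §3] [cite: Rogawski1990, §4.9 Prop. 4.9.1 (b) p. 55] [cite: Omeara1963, §63] -/
theorem isUnit_det_shift_denominators_of_level (L : Type) [Field L] [NumberField L] [IsCMField L]
    {v : HeightOneSpectrum (𝓞 ↥(maximalRealSubfield L))} (w : UnitaryGroup.PlacesOver L v) (hw : IsCMField.complexConj L • w.1 = w.1)
    (γH : (cmDatum L 2 (Matrix.of fun i j : Fin 2 => if i.val + j.val + 1 = 2 then (1 : L) else 0)).Local v ×
      (cmDatum L 1 (Matrix.of fun i j : Fin 1 => if i.val + j.val + 1 = 1 then (1 : L) else 0)).Local v)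
    {c : LocalRing L v} (hc : Valued.v (c w) = WithZero.exp (-1 : ℤ)) {j : ℕ} (hdom : Valued.v (c w) ^ j < Valued.v (2 : w.1.adicCompletion L))
    (hdeep : ∀ i k, Valued.v (((((endoEmbLocal L v γH).val : GL (Fin 3) (LocalRing L v)).val.map (Pi.evalRingHom (fun w' : UnitaryGroup.PlacesOver L v => w'.1.adicCompletion L) w)) - 1) i k) ≤ Valued.v (c w) ^ (j + 1)) :
    IsUnit ((c - 1) • ((((endoEmbLocal L v γH).val : GL (Fin 3) (LocalRing L v)).val : Matrix (Fin 3) (Fin 3) (LocalRing L v))) + (c + 1) • (1 : Matrix (Fin 3) (Fin 3) (LocalRing L v))).det ∧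
      IsUnit ((c + 1) • ((((endoEmbLocal L v γH).val : GL (Fin 3) (LocalRing L v)).val : Matrix (Fin 3) (Fin 3) (LocalRing L v))) + (c - 1) • (1 : Matrix (Fin 3) (Fin 3) (LocalRing L v))).det := by
  have hv : Subsingleton (UnitaryGroup.PlacesOver L v) := PlacesOver.subsingleton_of_smul_eq (IsCMField.complexConj L) (IsCMField.complexConj_ne_one L) w hw
  set evw : LocalRing L v →+* w.1.adicCompletion L := (Pi.evalRingHom (fun w' : UnitaryGroup.PlacesOver L v => w'.1.adicCompletion L) w) with hevw
  set cw : w.1.adicCompletion L := c w with hcw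
  set ιw : Matrix (Fin 3) (Fin 3) (w.1.adicCompletion L) := (((endoEmbLocal L v γH).val : GL (Fin 3) (LocalRing L v)).val.map evw) with hιw
  obtain ⟨hc0, hc1, hcm, hcp, -, -⟩ := shift_parameter_facts hc
  have hvc0 : Valued.v cw ≠ 0 := (Valuation.ne_zero_iff _).2 hc0
  -- `2 ≠ 0` is forced by the dominance hypothesis
  have hv20 : Valued.v (2 : w.1.adicCompletion L) ≠ 0 := fun h0 => by rw [h0] at hdom; exact not_lt_of_ge zero_le hdom
  have h20 : (2 : w.1.adicCompletion L) ≠ 0 := (Valuation.ne_zero_iff _).1 hv20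
  set W : Matrix (Fin 3) (Fin 3) (w.1.adicCompletion L) := cw⁻¹ • (ιw - 1) with hW
  have hιW : ιw = 1 + cw • W := eq_one_add_smul_inv_smul_sub_one hc0 ιw
  clear_value W
  have hWc : ∀ i k, Valued.v (W i k) ≤ Valued.v cw ^ j := by
    intro i k
    rw [hW, Matrix.smul_apply, smul_eq_mul, map_mul, map_inv₀]
    calc (Valued.v cw)⁻¹ * Valued.v ((ιw - 1) i k) ≤ (Valued.v cw)⁻¹ * Valued.v cw ^ (j + 1) := mul_le_mul_right (hdeep i k) _
      _ = Valued.v cw ^ j := by rw [pow_succ, mul_comm (Valued.v cw ^ j), ← mul_assoc, inv_mul_cancel₀ hvc0, one_mul]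
  -- `|2⁻¹ t W| < 1` for `|t| = 1`: this is the dominance `|c_w|^j < |2|_w`
  have hdet : ∀ {t : w.1.adicCompletion L}, Valued.v t = 1 →
      Valued.v ((2 : w.1.adicCompletion L) • (1 : Matrix (Fin 3) (Fin 3) (w.1.adicCompletion L)) + t • W).det = Valued.v (2 : w.1.adicCompletion L) ^ 3 := by
    intro t ht
    have e : (2 : w.1.adicCompletion L) • (1 : Matrix (Fin 3) (Fin 3) (w.1.adicCompletion L)) + t • W =
        (2 : w.1.adicCompletion L) • (1 + ((2 : w.1.adicCompletion L)⁻¹ * t) • W) := by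
      rw [smul_add, smul_smul, ← mul_assoc, mul_inv_cancel₀ h20, one_mul]
    have hM : ∀ i k, Valued.v (((1 + ((2 : w.1.adicCompletion L)⁻¹ * t) • W) - 1) i k) < 1 := fun i k => by
      rw [add_sub_cancel_left, Matrix.smul_apply, smul_eq_mul, map_mul, map_mul, map_inv₀, ht, mul_one]
      calc (Valued.v (2 : w.1.adicCompletion L))⁻¹ * Valued.v (W i k) ≤ (Valued.v (2 : w.1.adicCompletion L))⁻¹ * Valued.v cw ^ j :=
            mul_le_mul_right (hWc i k) _
        _ < (Valued.v (2 : w.1.adicCompletion L))⁻¹ * Valued.v (2 : w.1.adicCompletion L) := mul_lt_mul_of_pos_left hdom (inv_pos.2 (zero_lt_iff.2 hv20))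
        _ = 1 := inv_mul_cancel₀ hv20
    rw [e, Matrix.det_smul, Fintype.card_fin, map_mul, map_pow, v_det_eq_one_of_forall_v_sub_one_lt_one _ hM, mul_one]
  -- reading a denominator of `ι_v(γ_H)` at `w`
  have hread : ∀ a b : LocalRing L v, ((a • ((((endoEmbLocal L v γH).val : GL (Fin 3) (LocalRing L v)).val : Matrix (Fin 3) (Fin 3) (LocalRing L v))) + b • (1 : Matrix (Fin 3) (Fin 3) (LocalRing L v))).det) w =
      (a w • ιw + b w • (1 : Matrix (Fin 3) (Fin 3) (w.1.adicCompletion L))).det := fun a b => by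
    have e0 : ((a • ((((endoEmbLocal L v γH).val : GL (Fin 3) (LocalRing L v)).val : Matrix (Fin 3) (Fin 3) (LocalRing L v))) + b • (1 : Matrix (Fin 3) (Fin 3) (LocalRing L v))).det) w =
        evw ((a • ((((endoEmbLocal L v γH).val : GL (Fin 3) (LocalRing L v)).val : Matrix (Fin 3) (Fin 3) (LocalRing L v))) + b • (1 : Matrix (Fin 3) (Fin 3) (LocalRing L v))).det) := rfl
    rw [e0, RingHom.map_det, RingHom.mapMatrix_apply, map_smul_add_smul_one]
    rfl
  have hne : ∀ {x : LocalRing L v}, Valued.v (x w) = Valued.v cw ^ 3 * Valued.v (2 : w.1.adicCompletion L) ^ 3 → IsUnit x := fun {x} hx =>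
    isUnit_localRing_of_ne_zero_of_subsingleton L v hv fun h0 => by
      rw [h0, Pi.zero_apply, map_zero] at hx
      exact mul_ne_zero (pow_ne_zero 3 hvc0) (pow_ne_zero 3 hv20) hx.symm
  refine ⟨hne ?_, hne ?_⟩
  · rw [hread, show (c - 1) w = cw - 1 from rfl, show (c + 1) w = cw + 1 from rfl, hιW, smul_one_add_smul_add_smul_one W cw (cw - 1) (cw + 1) (by ring),
      Matrix.det_smul, Fintype.card_fin, map_mul, map_pow, hdet hcm]
  · rw [hread, show (c + 1) w = cw + 1 from rfl, show (c - 1) w = cw - 1 from rfl, hιW, smul_one_add_smul_add_smul_one W cw (cw + 1) (cw - 1) (by ring),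
      Matrix.det_smul, Fintype.card_fin, map_mul, map_pow, hdet hcp]

/-! ## §2 (G2) `stub_N5b` («`u_H → 1` as `γ_H → 1`») with the `|2|_w = 1` binder deleted -/

set_option maxHeartbeats 800000 in
-- the carriers' types are large (as ★ `exists_nhds_one_forall_shift_mem`)
/-- **(G2) N5b IN THE SHAPE OF THE N6 SOCKET `stub_N5b`, ANY residue characteristic** — ★ `exists_nhds_one_forall_shift_mem` with `(h2 : |2|_w = 1)` DELETED (supersedes it):
for every `V′ ∈ 𝓝 (1 : H_v)` there is `V ∈ 𝓝 1` such that for `γ_H ∈ V` every `u_H` with `u_H = φ_c(γ_H)` on both components lies in `V′` (`|c_w| = exp(−1)`).  Proof: ★ p851752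
gives a level `j₀ ≥ 1`; `|2|_w = exp(−e)` (★ `exists_valued_two_eq_exp_neg`); `j := max j₀ (e+1)`, `V :=` the level-`(j+1)` box (★ `setOf_entrywise_deep_mem_nhds_one`); there the
`3 × 3` denominators are units by (G1) (`|c_w|^j < |2|_w`), hence their blocks, and `u′ = φ_c(u)` as a scalar (★ `finGammaTwo_of_coe_eq_moebius`).
[cite: Rogawski1990, §4.9 p. 54; Prop. 4.9.1 p. 55] [cite: Kottwitz1986, §3] [cite: BernsteinZelevinsky1976, §1.1] [cite: Omeara1963, §63] -/

theorem exists_nhds_one_forall_shift_mem_dyadic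
    (L : Type) [Field L] [NumberField L] [IsCMField L] {v : HeightOneSpectrum (𝓞 ↥(maximalRealSubfield L))}
    (w : PlacesOver L v) (hw : IsCMField.complexConj L • w.1 = w.1)
    {c : LocalRing L v} (hc : Valued.v (c w) = WithZero.exp (-1 : ℤ))
    {V' : Set ((cmDatum L 2 (Matrix.of fun i j : Fin 2 => if i.val + j.val + 1 = 2 then (1 : L) else 0)).Local v × (cmDatum L 1 (Matrix.of fun i j : Fin 1 => if i.val + j.val + 1 = 1 then (1 : L) else 0)).Local v)} (hV' : V' ∈ 𝓝 (1 : ((cmDatum L 2 (Matrix.of fun i j : Fin 2 => if i.val + j.val + 1 = 2 then (1 : L) else 0)).Local v × (cmDatum L 1 (Matrix.of fun i j : Fin 1 => if i.val + j.val + 1 = 1 then (1 : L) else 0)).Local v))) :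
    ∃ V ∈ 𝓝 (1 : ((cmDatum L 2 (Matrix.of fun i j : Fin 2 => if i.val + j.val + 1 = 2 then (1 : L) else 0)).Local v × (cmDatum L 1 (Matrix.of fun i j : Fin 1 => if i.val + j.val + 1 = 1 then (1 : L) else 0)).Local v)), ∀ γH ∈ V, ∀ uH : ((cmDatum L 2 (Matrix.of fun i j : Fin 2 => if i.val + j.val + 1 = 2 then (1 : L) else 0)).Local v × (cmDatum L 1 (Matrix.of fun i j : Fin 1 => if i.val + j.val + 1 = 1 then (1 : L) else 0)).Local v),
      (((uH.1.val : GL (Fin 2) (LocalRing L v)).val : Matrix (Fin 2) (Fin 2) (LocalRing L v)) =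
        ((c + 1) • ((γH.1.val : GL (Fin 2) (LocalRing L v)).val : Matrix (Fin 2) (Fin 2) (LocalRing L v)) + (c - 1) • 1) *
          ((c - 1) • ((γH.1.val : GL (Fin 2) (LocalRing L v)).val : Matrix (Fin 2) (Fin 2) (LocalRing L v)) + (c + 1) • 1)⁻¹) →
      (((uH.2.val : GL (Fin 1) (LocalRing L v)).val : Matrix (Fin 1) (Fin 1) (LocalRing L v)) =
        ((c + 1) • ((γH.2.val : GL (Fin 1) (LocalRing L v)).val : Matrix (Fin 1) (Fin 1) (LocalRing L v)) + (c - 1) • 1) *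
          ((c - 1) • ((γH.2.val : GL (Fin 1) (LocalRing L v)).val : Matrix (Fin 1) (Fin 1) (LocalRing L v)) + (c + 1) • 1)⁻¹) →
      uH ∈ V' := by
  obtain ⟨j₀, hj₀, hV⟩ := exists_level_forall_shift_mem_of_mem_nhds_one_dyadic L w hw hc hV'
  obtain ⟨e, he⟩ := exists_valued_two_eq_exp_neg L w.1
  obtain ⟨hc0, hc1, -, -, -, -⟩ := shift_parameter_facts hc
  -- the level: deeper than the box and than `ord 2`
  set j : ℕ := max j₀ (e + 1) with hjdef
  have hj0 : j₀ ≤ j := le_max_left _ _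
  have hje : e + 1 ≤ j := le_max_right _ _
  have hdom : Valued.v (c w) ^ j < Valued.v (2 : w.1.adicCompletion L) := pow_lt_valued_two_of_exp hc he hje
  have hcj0 : (c w) ^ (j + 1) ≠ 0 := pow_ne_zero _ hc0
  refine ⟨_, setOf_entrywise_deep_mem_nhds_one L v w hcj0, fun γH hγ uH h1 h2' => ?_⟩
  obtain ⟨hg, hu⟩ := hγ
  have hg' : ∀ i k, Valued.v ((((γH.1.val : GL (Fin 2) (LocalRing L v)).val.map (Pi.evalRingHom (fun w' : PlacesOver L v => w'.1.adicCompletion L) w)) - 1) i k) ≤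
      Valued.v (c w) ^ (j + 1) := fun i k => by rw [← Valuation.map_pow]; exact hg i k
  have hu' : Valued.v (finGammaTwo L v γH w - 1) ≤ Valued.v (c w) ^ (j + 1) := by rw [← Valuation.map_pow]; exact hu
  -- level `j + 1 ≥ j₀ + 1`: the box of ★ p851752
  have hpj : Valued.v (c w) ^ (j + 1) ≤ Valued.v (c w) ^ (j₀ + 1) := pow_le_pow_right_of_le_one' hc1.le (by omega)
  -- level `j + 1` with `|c|^j < |2|` ⇒ the `3 × 3` denominator is a unit (G1), hence so are its two blocks
  have hdeep := forall_valued_endoEmbLocal_sub_one_le_of_blocks L v w γH (t := Valued.v (c w) ^ (j + 1)) hg' hu'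
  obtain ⟨hD3, -⟩ := isUnit_det_shift_denominators_of_level L w hw γH hc hdom hdeep
  rw [coe_endoEmbLocal, coe_endoGL, smul_reindex_add_smul_one, smul_fromBlocks_add_smul_one, Matrix.det_reindex_self, Matrix.det_fromBlocks_zero₁₂] at hD3
  have hD1 := isUnit_of_mul_isUnit_left hD3
  have hD2 := isUnit_of_mul_isUnit_right hD3
  have hμ₂ : IsUnit ((c - 1) * finGammaTwo L v γH + (c + 1)) := by
    have e' : ((c - 1) • ((γH.2.val : GL (Fin 1) (LocalRing L v)).val : Matrix (Fin 1) (Fin 1) (LocalRing L v)) + (c + 1) • (1 : Matrix (Fin 1) (Fin 1) (LocalRing L v))).det =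
        (c - 1) * finGammaTwo L v γH + (c + 1) := by
      rw [Matrix.det_fin_one]
      simp [finGammaTwo, Matrix.one_apply_eq]
    rw [← e']; exact hD2
  exact hV γH uH (fun i k => (hg' i k).trans hpj) (hu'.trans hpj) hD1 hμ₂ h1 (finGammaTwo_of_coe_eq_moebius L v γH uH c h2')

end Literature.NumberTheory.Rogawski1990

end
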